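import Summits.QuantumFields.QCD.Theses.NestedDissectionSea

/-!
# Crux `CoerciveSea` (stmt-QuantumFields-13901) — the separator event IS the Schur separator's near-kernel
# (harmonic extension ↔ Schur complement, exact linear algebra)

Helper file of the kept line lead (c1), line `chirality-collapses-pseudospectrum`, usable by every line of the crux and by
the bridge `SeaFactorisationBridge` (which reads clause (i) as "the Schur separator `S_Σ` is `τ`-coercive off a
`t^α`-rare set"). Clause (i) of the crux is stated in HARMONIC-EXTENSION form (`HasSingularSeparator U μ s τ`: a vector
on the box, harmonic on the sixteen children interiors, non-zero on the internal separator `Σ`, with separator residual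
`< τ ×` its separator mass), while the route's factorisation (`SchurCellStep`, `sepFactor`) and the bridge speak of the
SCHUR SEPARATOR MATRIX `schurSeparator U μ s = D_ΣΣ − D_ΣI D_II⁻¹ D_IΣ` (tree `WilsonCellSchur`). This file proves they
are the same event whenever the children block `D_II = childrenBlock U μ s` is invertible (which is the case off the
children's own crossing masses, in particular whenever the children are coercive):

* generic block algebra for a square matrix `M` and a predicate `pr` (children interior) with `A = M_pp` invertible,
  `S = M_qq − M_qp A⁻¹ M_pq` (`q = ¬p`): `mulVec_apply_pos/neg` (row of `M *ᵥ w` split into the two blocks),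
  the harmonic extension `w` of separator data `v` (`w_p = −A⁻¹ M_pq v`, `w_q = v`, characterised by its restrictions —
  no definition is introduced) with `mulVec_harmonicExt_pos` (`(M w)_p = 0`) and `mulVec_harmonicExt_neg`
  (`(M w)_q = S v`), and conversely
  `mulVec_neg_of_harmonic` (ANY harmonic `w` has `(M w)_q = S w_q`);
* `hasSingularSeparator_iff_schur` (registered stub of the crux item) — for the Dirichlet Wilson cell:
  `IsUnit (childrenBlock U μ s).det → (HasSingularSeparator U μ s τ ↔ ∃ v ≠ 0 on Σ, ‖S_Σ v‖² < τ² ‖v‖²)`,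
  i.e. the crux's event is exactly "`σ_min(S_Σ(μ)) < τ`".

Cè–Giusti–Schaefer 2017, App. A (Schur complement of the Dirac operator on a domain boundary) is the source of the
identification; here it is finite-dimensional block algebra (`Matrix.toBlock`, `Matrix.mul_nonsing_inv`). [folklore]
-/

noncomputable section

open scoped BigOperators
open Matrix Literature.MathematicalPhysics.QuantumLattice Literature.MathematicalPhysics.QuantumFieldTheory
  Literature.Probability.LatticeModels

namespace Summit.QuantumFields.QCD.Theorems.NestedDissectionSeaCoerciveSea

/-! ### Generic block algebra: harmonic extension and Schur complement -/

section Generic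

variable {m : Type*} [Fintype m] [DecidableEq m] (M : Matrix m m ℂ) (pr : m → Prop) [DecidablePred pr]

omit [DecidableEq m] in
/-- A row of `M *ᵥ w` at an index IN the block `pr`, split into the `pp` and `pq` blocks. [folklore] -/
theorem mulVec_apply_pos (w : m → ℂ) (a : {a // pr a}) :
    (M *ᵥ w) a = (M.toBlock pr pr *ᵥ fun b => w b) a +
      (M.toBlock pr (fun b => ¬ pr b) *ᵥ fun b => w b) a := by
  simp only [Matrix.mulVec, dotProduct, Matrix.toBlock_apply]
  exact (Fintype.sum_subtype_add_sum_subtype pr (fun b => M a b * w b)).symm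

omit [DecidableEq m] in
/-- A row of `M *ᵥ w` at an index OUTSIDE the block `pr`, split into the `qp` and `qq` blocks. [folklore] -/
theorem mulVec_apply_neg (w : m → ℂ) (a : {a // ¬ pr a}) :
    (M *ᵥ w) a = (M.toBlock (fun b => ¬ pr b) pr *ᵥ fun b => w b) a +
      (M.toBlock (fun b => ¬ pr b) (fun b => ¬ pr b) *ᵥ fun b => w b) a := by
  simp only [Matrix.mulVec, dotProduct, Matrix.toBlock_apply]
  exact (Fintype.sum_subtype_add_sum_subtype pr (fun b => M a b * w b)).symm

/-- A **harmonic extension** of separator data `v` (indices outside `pr`) through the block `pr` is a vector `w` with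
`w_q = v` and `w_p = −(M_pp)⁻¹ M_pq v`; it IS harmonic on the block when `M_pp` is invertible: `(M w)_p = 0`.
(No definition is introduced: `w` is characterised by its two restrictions.) [folklore] -/
theorem mulVec_harmonicExt_pos (hA : IsUnit (M.toBlock pr pr).det) (v : {a // ¬ pr a} → ℂ) (w : m → ℂ)
    (hwp : (fun b : {a // pr a} => w b) = -((M.toBlock pr pr)⁻¹ *ᵥ (M.toBlock pr (fun b => ¬ pr b) *ᵥ v)))
    (hwq : (fun b : {a // ¬ pr a} => w b) = v) (a : {a // pr a}) :
    (M *ᵥ w) a = 0 := by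
  rw [mulVec_apply_pos, hwp, hwq, Matrix.mulVec_neg, Matrix.mulVec_mulVec,
    Matrix.mul_nonsing_inv _ hA, Matrix.one_mulVec]
  simp

/-- On the complement a harmonic extension is acted on by the SCHUR COMPLEMENT:
`(M w)_q = (M_qq − M_qp M_pp⁻¹ M_pq) v`. [folklore] -/
theorem mulVec_harmonicExt_neg (v : {a // ¬ pr a} → ℂ) (w : m → ℂ)
    (hwp : (fun b : {a // pr a} => w b) = -((M.toBlock pr pr)⁻¹ *ᵥ (M.toBlock pr (fun b => ¬ pr b) *ᵥ v)))
    (hwq : (fun b : {a // ¬ pr a} => w b) = v) (a : {a // ¬ pr a}) :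
    (M *ᵥ w) a =
      ((M.toBlock (fun b => ¬ pr b) (fun b => ¬ pr b) -
          M.toBlock (fun b => ¬ pr b) pr * (M.toBlock pr pr)⁻¹ * M.toBlock pr (fun b => ¬ pr b)) *ᵥ v) a := by
  rw [mulVec_apply_neg, hwp, hwq, Matrix.sub_mulVec, Matrix.mulVec_neg,
    ← Matrix.mulVec_mulVec, ← Matrix.mulVec_mulVec]
  simp only [Pi.neg_apply, Pi.sub_apply]
  ring

/-- Conversely, ANY vector harmonic on the block (`(M w)_p = 0`) is the harmonic extension of its complement data, so
the Schur complement acts on it: `(M w)_q = S w_q` (needs `M_pp` invertible). [folklore] -/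
theorem mulVec_neg_of_harmonic (hA : IsUnit (M.toBlock pr pr).det) (w : m → ℂ)
    (hharm : ∀ a : {a // pr a}, (M *ᵥ w) a = 0) (a : {a // ¬ pr a}) :
    (M *ᵥ w) a =
      ((M.toBlock (fun b => ¬ pr b) (fun b => ¬ pr b) -
          M.toBlock (fun b => ¬ pr b) pr * (M.toBlock pr pr)⁻¹ * M.toBlock pr (fun b => ¬ pr b)) *ᵥ
        fun b => w b) a := by
  -- the block part of `w` is determined by the harmonicity: `w_p = −A⁻¹ B w_q`
  have hAp : (M.toBlock pr pr *ᵥ fun b => w b) = -(M.toBlock pr (fun b => ¬ pr b) *ᵥ fun b => w b) := by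
    funext b
    have := hharm b
    rw [mulVec_apply_pos] at this
    rw [Pi.neg_apply]
    exact eq_neg_of_add_eq_zero_left this
  have hwp : (fun b : {a // pr a} => w b) =
      -((M.toBlock pr pr)⁻¹ *ᵥ (M.toBlock pr (fun b => ¬ pr b) *ᵥ fun b => w b)) := by
    have h1 : (M.toBlock pr pr)⁻¹ *ᵥ (M.toBlock pr pr *ᵥ fun b => w b) = fun b : {a // pr a} => w b := by
      rw [Matrix.mulVec_mulVec, Matrix.nonsing_inv_mul _ hA, Matrix.one_mulVec]
    rw [← h1, hAp, Matrix.mulVec_neg]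
  rw [mulVec_apply_neg, hwp, Matrix.sub_mulVec, Matrix.mulVec_neg, ← Matrix.mulVec_mulVec, ← Matrix.mulVec_mulVec]
  simp only [Pi.neg_apply, Pi.sub_apply]
  ring

omit [DecidableEq m] in
/-- Sums of a complement-supported `ite` reduce to the complement subtype. [folklore] -/
theorem sum_ite_eq_sum_subtype_neg (g : m → ℝ) :
    ∑ a, (if pr a then (0 : ℝ) else g a) = ∑ b : {a // ¬ pr a}, g b := by
  rw [← Fintype.sum_subtype_add_sum_subtype pr (fun a => if pr a then (0 : ℝ) else g a)]
  have h1 : ∑ b : {a // pr a}, (if pr b then (0 : ℝ) else g b) = 0 :=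
    Finset.sum_eq_zero fun b _ => if_pos b.2
  have h2 : ∑ b : {a // ¬ pr a}, (if pr b then (0 : ℝ) else g b) = ∑ b : {a // ¬ pr a}, g b :=
    Finset.sum_congr rfl fun b _ => if_neg b.2
  rw [h1, h2, zero_add]

end Generic

/-! ### The crux's separator event is the Schur separator's near-kernel -/

variable {N : ℕ} [NeZero N]

/-- **`HasSingularSeparator` ↔ `σ_min(S_Σ) < τ`** (registered stub `hasSingularSeparator_iff_schur` of crux
stmt-QuantumFields-13901). For the Dirichlet Wilson cell of the corner-`0` box `s` of any `SU(3)` field at any bare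
mass `μ`, IF the children block `childrenBlock U μ s = D_II` is invertible, then the crux's separator event at level `τ`
(a vector harmonic on the children interiors, non-zero on the separator, separator residual `< τ ×` separator mass)
holds iff the Schur separator matrix `schurSeparator U μ s = D_ΣΣ − D_ΣI D_II⁻¹ D_IΣ` has a non-zero vector `v` on the
separator with `Σ_q ‖(S_Σ v)_q‖² < τ² Σ_q ‖v_q‖²`. (→: restrict the harmonic vector to `Σ`, `mulVec_neg_of_harmonic`;
←: the explicit harmonic extension, `mulVec_harmonicExt_pos/neg`.) [folklore] -/
theorem hasSingularSeparator_iff_schur :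
    ∀ (N : ℕ) [NeZero N] (U : GaugeConfig 4 N (Matrix.specialUnitaryGroup (Fin 3) ℂ)) (μ : ℝ) (s : Fin 4 → ℕ)
      (τ : ℝ), IsUnit (childrenBlock U μ s).det →
      (HasSingularSeparator U μ s τ ↔
        ∃ v : {p : {p // wilsonBox (0 : TorusSite 4 N) s p} // ¬ childrenInterior s p} → ℂ, v ≠ 0 ∧
          ∑ q, ‖(schurSeparator U μ s).mulVec v q‖ ^ 2 < τ ^ 2 * ∑ q, ‖v q‖ ^ 2) := by
  intro N _ U μ s τ hA
  have hA' : IsUnit ((wilsonCell U μ 0 s).toBlock (childrenInterior s) (childrenInterior s)).det := hA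
  have hS : schurSeparator U μ s =
      (wilsonCell U μ 0 s).toBlock (fun p => ¬ childrenInterior s p) (fun p => ¬ childrenInterior s p) -
        (wilsonCell U μ 0 s).toBlock (fun p => ¬ childrenInterior s p) (childrenInterior s) *
            ((wilsonCell U μ 0 s).toBlock (childrenInterior s) (childrenInterior s))⁻¹ *
          (wilsonCell U μ 0 s).toBlock (childrenInterior s) (fun p => ¬ childrenInterior s p) := rfl
  constructor
  · rintro ⟨w, ⟨p₀, hp₀, hw₀⟩, hharm, hres⟩
    refine ⟨fun q => w q, fun h0 => hw₀ (by simpa using congr_fun h0 ⟨p₀, hp₀⟩), ?_⟩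
    have hharm' : ∀ a : {p : {p // wilsonBox (0 : TorusSite 4 N) s p} // childrenInterior s p}, (wilsonCell U μ 0 s *ᵥ w) a = 0 := fun a => hharm a a.2
    have hrow : ∀ q : {p : {p // wilsonBox (0 : TorusSite 4 N) s p} // ¬ childrenInterior s p},
        (wilsonCell U μ 0 s *ᵥ w) q = (schurSeparator U μ s *ᵥ fun b => w b) q := fun q => by
      rw [hS]; exact mulVec_neg_of_harmonic (wilsonCell U μ 0 s) (childrenInterior s) hA' w hharm' q
    rw [sum_ite_eq_sum_subtype_neg (childrenInterior s) (fun p => ‖(wilsonCell U μ 0 s *ᵥ w) p‖ ^ 2),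
      sum_ite_eq_sum_subtype_neg (childrenInterior s) (fun p => ‖w p‖ ^ 2)] at hres
    simp only [hrow] at hres
    exact hres
  · rintro ⟨v, hv0, hres⟩
    obtain ⟨q₀, hq₀⟩ : ∃ q, v q ≠ 0 := by
      by_contra h
      push Not at h
      exact hv0 (funext h)
    -- the harmonic extension of `v` through the children block
    let w : {p // wilsonBox (0 : TorusSite 4 N) s p} → ℂ := fun a =>
      if h : childrenInterior s a then
        (-(((wilsonCell U μ 0 s).toBlock (childrenInterior s) (childrenInterior s))⁻¹ *ᵥ
            ((wilsonCell U μ 0 s).toBlock (childrenInterior s) (fun b => ¬ childrenInterior s b) *ᵥ v))) ⟨a, h⟩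
      else v ⟨a, h⟩
    have hwp : (fun b : {p : {p // wilsonBox (0 : TorusSite 4 N) s p} // childrenInterior s p} => w b) =
        -(((wilsonCell U μ 0 s).toBlock (childrenInterior s) (childrenInterior s))⁻¹ *ᵥ
            ((wilsonCell U μ 0 s).toBlock (childrenInterior s) (fun b => ¬ childrenInterior s b) *ᵥ v)) := by
      funext b
      simp only [w, dif_pos b.2]
    have hwq : (fun b : {p : {p // wilsonBox (0 : TorusSite 4 N) s p} // ¬ childrenInterior s p} => w b) = v := by
      funext b
      simp only [w, dif_neg b.2]
    have hwq' : ∀ q : {p : {p // wilsonBox (0 : TorusSite 4 N) s p} // ¬ childrenInterior s p}, w q = v q :=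
      fun q => congr_fun hwq q
    refine ⟨w, ⟨q₀, q₀.2, ?_⟩, fun p hp => ?_, ?_⟩
    · rw [hwq' q₀]; exact hq₀
    · exact mulVec_harmonicExt_pos (wilsonCell U μ 0 s) (childrenInterior s) hA' v w hwp hwq ⟨p, hp⟩
    · rw [sum_ite_eq_sum_subtype_neg (childrenInterior s) (fun p => ‖(wilsonCell U μ 0 s *ᵥ w) p‖ ^ 2),
        sum_ite_eq_sum_subtype_neg (childrenInterior s) (fun p => ‖w p‖ ^ 2)]
      have h1 : ∀ q : {p : {p // wilsonBox (0 : TorusSite 4 N) s p} // ¬ childrenInterior s p},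
          (wilsonCell U μ 0 s *ᵥ w) q = (schurSeparator U μ s *ᵥ v) q := fun q => by
        rw [hS]; exact mulVec_harmonicExt_neg (wilsonCell U μ 0 s) (childrenInterior s) v w hwp hwq q
      simp only [h1, hwq']
      exact hres

end Summit.QuantumFields.QCD.Theorems.NestedDissectionSeaCoerciveSea

end
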